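import Literature.Topology.FourManifolds.GaussDiagramsGenericity
import HarnessLib

/-!
# Generic first-harmonic perturbations of a plane curve have transverse double points

Topic `Literature/Topology/FourManifolds`; continuation of `GaussDiagramsGenericity.lean` (same
purpose: the proof of the named fact
`Literature.Topology.FourManifolds.Knot.exists_hasGaussDiagram_of_isIsotopic` of `GaussDiagrams.lean`;
Reidemeister, *Knotentheorie* (1932), Kap. I §1; Cromwell, *Knots and Links* (2004), Thm. 3.2.1).
Everything here is proved; no named facts.

For the family `pert γ (v, w) θ = γ θ + cos θ • v + sin θ • w` of `GaussDiagramsGenericity.lean`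
this file shows that for Lebesgue-almost every `q = (v, w)` every double point
`pert γ q s = pert γ q t`, `s ≢ t (mod 2π)`, is **transverse**: `cross (pertDeriv γ q s)
(pertDeriv γ q t) ≠ 0` (`cross_pertDeriv_ne_zero`, `measure_pertBad₂_eq_zero`), and assembles the
three genericity statements into `exists_pert_generic` (a generic parameter in every ball).
(These are the declarations `pertChart₁`/`pertChart₂`, `measure_pertBad₂_eq_zero`,
`cross_pertDeriv_ne_zero` and `exists_pert_generic` announced as item 2 in the module docstring of
`GaussDiagramsGenericity.lean`, which contains items 1 and 3 only.)

**Proof** (the parametric transversality theorem, Guillemin–Pollack (1974), Ch. 2 §3, in its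
simplest instance; Sard (1942), Milnor (1965) §3). The solution set
`M = {(q, s, t) | pert γ q s = pert γ q t}` of the double-point equation
`γ s - γ t + (cos s - cos t) • v + (sin s - sin t) • w = 0` is a graph: where `cos s ≠ cos t` it
determines `v` from `((s, t), w)` (`pertSolve₁`), where `sin s ≠ sin t` it determines `w` from
`((s, t), v)` (`pertSolve₂`); one of the two happens unless `s ≡ t`. Accordingly the projection
`M → {q}` is read as the explicit self-maps `pertChart₁ ((s, t), w) = (pertSolve₁, w)`,
`pertChart₂ ((s, t), v) = (v, pertSolve₂)` of `ℝ² × ℝ²`. Implicit differentiation of the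
double-point equation along the line `τ ↦ ((s + τa, t + τb), w)` (`fderiv_pertChart₁_apply_eq_zero`)
shows: if the velocities at a double point are dependent, `a • pert' s = b • pert' t` with
`(a, b) ≠ 0`, then `((a, b), 0)` is in the kernel of the differential of the chart map, so the
parameter `q` is a critical value; by Mathlib's fixed-dimension Sard theorem
(`MeasureTheory.addHaar_image_eq_zero_of_det_fderivWithin_eq_zero`) the critical values are null.

## References

* A. Sard, Bull. AMS 48 (1942) 883–890. [Sard1942]
* J. Milnor, *Topology from the differentiable viewpoint* (1965), §§2–3. [MilnorTDV1965]
* V. Guillemin, A. Pollack, *Differential topology* (1974), Ch. 2 §3. [GuilleminPollack2010]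

## Design notes

The two charts are treated by two parallel computations (the second is the first with the roles
of `cos • v` and `sin • w` exchanged). No statement of another file is modified; no `sorry`.
-/

open Set Function Module Filter
open _root_.MeasureTheory _root_.MeasureTheory.Measure
open scoped Topology ContDiff

noncomputable section

namespace Literature.Topology.FourManifolds

variable {γ : ℝ → ℝ × ℝ}

/-! ### A non-injective endomorphism has determinant zero -/

/-- A continuous linear endomorphism of a finite-dimensional real space which is not injective has
determinant `0`. [folklore] -/
theorem det_eq_zero_of_not_injective_clm {E : Type*} [NormedAddCommGroup E] [NormedSpace ℝ E]
    [FiniteDimensional ℝ E] {A : E →L[ℝ] E} (hA : ¬ Injective A) : A.det = 0 := by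
  rw [ContinuousLinearMap.det, LinearMap.det_eq_zero_iff_ker_ne_bot, Ne, LinearMap.ker_eq_bot]
  exact hA

/-! ### Lines in the parameter plane -/

/-- The derivative of `τ ↦ c + τ * a` is `a`. [folklore] -/
theorem hasDerivAt_const_add_mul (c a τ : ℝ) : HasDerivAt (fun τ : ℝ ↦ c + τ * a) a τ := by
  simpa using ((hasDerivAt_id τ).mul_const a).const_add c

/-- Derivative of `τ ↦ γ (c + τ * a)` at `0`. [folklore] -/
theorem hasDerivAt_comp_line (hγ : Differentiable ℝ γ) (c a : ℝ) :
    HasDerivAt (fun τ : ℝ ↦ γ (c + τ * a)) (a • deriv γ c) 0 := by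
  have h0 : (fun τ : ℝ ↦ c + τ * a) 0 = c := by simp
  have hg : HasDerivAt γ (deriv γ c) ((fun τ : ℝ ↦ c + τ * a) 0) := by
    rw [h0]; exact (hγ c).hasDerivAt
  exact hg.scomp 0 (hasDerivAt_const_add_mul c a 0)

/-- Derivative of `τ ↦ cos (c + τ * a)` at `0`. [folklore] -/
theorem hasDerivAt_cos_line (c a : ℝ) :
    HasDerivAt (fun τ : ℝ ↦ Real.cos (c + τ * a)) (-Real.sin c * a) 0 := by
  have h0 : (fun τ : ℝ ↦ c + τ * a) 0 = c := by simp
  have hg : HasDerivAt Real.cos (-Real.sin c) ((fun τ : ℝ ↦ c + τ * a) 0) := by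
    rw [h0]; exact Real.hasDerivAt_cos c
  exact hg.comp 0 (hasDerivAt_const_add_mul c a 0)

/-- Derivative of `τ ↦ sin (c + τ * a)` at `0`. [folklore] -/
theorem hasDerivAt_sin_line (c a : ℝ) :
    HasDerivAt (fun τ : ℝ ↦ Real.sin (c + τ * a)) (Real.cos c * a) 0 := by
  have h0 : (fun τ : ℝ ↦ c + τ * a) 0 = c := by simp
  have hg : HasDerivAt Real.sin (Real.cos c) ((fun τ : ℝ ↦ c + τ * a) 0) := by
    rw [h0]; exact Real.hasDerivAt_sin c
  exact hg.comp 0 (hasDerivAt_const_add_mul c a 0)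

/-- The line `τ ↦ ((s + τa, t + τb), w)` in `ℝ² × ℝ²`. [folklore] -/
def pertLine (p : (ℝ × ℝ) × (ℝ × ℝ)) (ab : ℝ × ℝ) (τ : ℝ) : (ℝ × ℝ) × (ℝ × ℝ) :=
  ((p.1.1 + τ * ab.1, p.1.2 + τ * ab.2), p.2)

/-- The line passes through `p` at `τ = 0`. [folklore] -/
@[simp] theorem pertLine_zero (p : (ℝ × ℝ) × (ℝ × ℝ)) (ab : ℝ × ℝ) : pertLine p ab 0 = p := by
  simp [pertLine]

/-- The velocity of the line is `(ab, 0)`. [folklore] -/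
theorem hasDerivAt_pertLine (p : (ℝ × ℝ) × (ℝ × ℝ)) (ab : ℝ × ℝ) (τ : ℝ) :
    HasDerivAt (pertLine p ab) (ab, 0) τ := by
  have h := ((hasDerivAt_const_add_mul p.1.1 ab.1 τ).prodMk
    (hasDerivAt_const_add_mul p.1.2 ab.2 τ)).prodMk (hasDerivAt_const τ p.2)
  exact h

/-- The line is continuous. [folklore] -/
theorem continuous_pertLine (p : (ℝ × ℝ) × (ℝ × ℝ)) (ab : ℝ × ℝ) : Continuous (pertLine p ab) := by
  unfold pertLine; fun_prop

/-! ### The first chart: solving the double-point equation for `v` -/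

/-- **Solving the double-point equation for `v`** where `cos s ≠ cos t`: for `p = ((s, t), w)`,
`pertSolve₁ γ p = (cos s - cos t)⁻¹ • (-(γ s - γ t) - (sin s - sin t) • w)`. [folklore] -/
def pertSolve₁ (γ : ℝ → ℝ × ℝ) (p : (ℝ × ℝ) × (ℝ × ℝ)) : ℝ × ℝ :=
  (Real.cos p.1.1 - Real.cos p.1.2)⁻¹ •
    (-(γ p.1.1 - γ p.1.2) - (Real.sin p.1.1 - Real.sin p.1.2) • p.2)

/-- **The first chart map** `((s, t), w) ↦ (pertSolve₁, w)`, a self-map of `ℝ² × ℝ²` whose values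
on `{cos s ≠ cos t}` are exactly the parameters `q` with the double point `(s, t)`. [folklore] -/
def pertChart₁ (γ : ℝ → ℝ × ℝ) (p : (ℝ × ℝ) × (ℝ × ℝ)) : (ℝ × ℝ) × (ℝ × ℝ) :=
  (pertSolve₁ γ p, p.2)

/-- The domain `{cos s ≠ cos t}` of the first chart. [folklore] -/
def pertDom₁ : Set ((ℝ × ℝ) × (ℝ × ℝ)) :=
  {p | Real.cos p.1.1 ≠ Real.cos p.1.2}

/-- The domain of the first chart is open. [folklore] -/
theorem isOpen_pertDom₁ : IsOpen pertDom₁ :=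
  isOpen_ne_fun (by fun_prop) (by fun_prop)

/-- The defining identity of `pertSolve₁`. [folklore] -/
theorem smul_pertSolve₁ {p : (ℝ × ℝ) × (ℝ × ℝ)} (hp : p ∈ pertDom₁) :
    (Real.cos p.1.1 - Real.cos p.1.2) • pertSolve₁ γ p =
      -(γ p.1.1 - γ p.1.2) - (Real.sin p.1.1 - Real.sin p.1.2) • p.2 := by
  rw [pertSolve₁, smul_smul, mul_inv_cancel₀ (sub_ne_zero.2 hp), one_smul]

/-- **The graph property**: on its domain the first chart map produces parameters with the double
point `(s, t)`. [folklore] -/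
theorem pert_pertChart₁_eq {p : (ℝ × ℝ) × (ℝ × ℝ)} (hp : p ∈ pertDom₁) :
    pert γ (pertChart₁ γ p) p.1.1 = pert γ (pertChart₁ γ p) p.1.2 := by
  have h := smul_pertSolve₁ (γ := γ) hp
  simp only [pert_apply, pertChart₁]
  rw [sub_smul] at h
  linear_combination (norm := module) h

/-- **Uniqueness**: a parameter `q` with the double point `(s, t)`, `cos s ≠ cos t`, is the value of
the first chart map at `((s, t), q.2)`. [folklore] -/
theorem pertChart₁_eq_of_pert_eq {q : (ℝ × ℝ) × (ℝ × ℝ)} {s t : ℝ} (hst : Real.cos s ≠ Real.cos t)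
    (h : pert γ q s = pert γ q t) : pertChart₁ γ ((s, t), q.2) = q := by
  refine Prod.ext ?_ rfl
  show pertSolve₁ γ ((s, t), q.2) = q.1
  have hc : Real.cos s - Real.cos t ≠ 0 := sub_ne_zero.2 hst
  have hq : (Real.cos s - Real.cos t) • q.1 = -(γ s - γ t) - (Real.sin s - Real.sin t) • q.2 := by
    rw [pert_apply, pert_apply] at h
    rw [sub_smul, sub_smul]
    linear_combination (norm := module) h
  rw [pertSolve₁]
  show (Real.cos s - Real.cos t)⁻¹ • (-(γ s - γ t) - (Real.sin s - Real.sin t) • q.2) = q.1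
  rw [← hq, smul_smul, inv_mul_cancel₀ hc, one_smul]

/-- `pertSolve₁` is `C^∞` on the domain. [folklore] -/
theorem contDiffOn_pertSolve₁ (hγ : ContDiff ℝ ∞ γ) : ContDiffOn ℝ ∞ (pertSolve₁ γ) pertDom₁ := by
  have h1 : ContDiff ℝ ∞ fun p : (ℝ × ℝ) × (ℝ × ℝ) ↦ γ p.1.1 := hγ.comp (contDiff_fst.comp contDiff_fst)
  have h2 : ContDiff ℝ ∞ fun p : (ℝ × ℝ) × (ℝ × ℝ) ↦ γ p.1.2 := hγ.comp (contDiff_snd.comp contDiff_fst)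
  have hinv : ContDiffOn ℝ ∞ (fun p : (ℝ × ℝ) × (ℝ × ℝ) ↦ (Real.cos p.1.1 - Real.cos p.1.2)⁻¹)
      pertDom₁ :=
    ContDiffOn.inv (by fun_prop) fun p hp ↦ sub_ne_zero.2 hp
  unfold pertSolve₁
  refine hinv.smul (ContDiff.contDiffOn ?_)
  exact (h1.sub h2).neg.sub ((Real.contDiff_sin.comp (contDiff_fst.comp contDiff_fst)).sub
    (Real.contDiff_sin.comp (contDiff_snd.comp contDiff_fst)) |>.smul contDiff_snd)

/-- The first chart map is `C^∞` on the domain. [folklore] -/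
theorem contDiffOn_pertChart₁ (hγ : ContDiff ℝ ∞ γ) : ContDiffOn ℝ ∞ (pertChart₁ γ) pertDom₁ :=
  (contDiffOn_pertSolve₁ hγ).prodMk contDiffOn_snd

/-- `pertSolve₁` is differentiable at the points of the domain. [folklore] -/
theorem differentiableAt_pertSolve₁ (hγ : ContDiff ℝ ∞ γ) {p : (ℝ × ℝ) × (ℝ × ℝ)}
    (hp : p ∈ pertDom₁) : DifferentiableAt ℝ (pertSolve₁ γ) p :=
  ((contDiffOn_pertSolve₁ hγ).differentiableOn (by simp) p hp).differentiableAt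
    (isOpen_pertDom₁.mem_nhds hp)

/-- The first chart map is differentiable at the points of the domain. [folklore] -/
theorem differentiableAt_pertChart₁ (hγ : ContDiff ℝ ∞ γ) {p : (ℝ × ℝ) × (ℝ × ℝ)}
    (hp : p ∈ pertDom₁) : DifferentiableAt ℝ (pertChart₁ γ) p :=
  (differentiableAt_pertSolve₁ hγ hp).prodMk differentiableAt_snd

/-- The differential of the first chart map: `D(pertChart₁) z = (D(pertSolve₁) z, z.2)`. [folklore] -/
theorem fderiv_pertChart₁_apply (hγ : ContDiff ℝ ∞ γ) {p : (ℝ × ℝ) × (ℝ × ℝ)} (hp : p ∈ pertDom₁)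
    (z : (ℝ × ℝ) × (ℝ × ℝ)) :
    fderiv ℝ (pertChart₁ γ) p z = (fderiv ℝ (pertSolve₁ γ) p z, z.2) := by
  have h := (differentiableAt_pertSolve₁ hγ hp).hasFDerivAt.prodMk (hasFDerivAt_snd (p := p))
  rw [show pertChart₁ γ = fun p ↦ (pertSolve₁ γ p, p.2) from rfl, h.fderiv]
  rfl

/-- The velocity of the perturbed curve for the parameter `pertChart₁ γ p = (pertSolve₁ γ p, w)`.
[folklore] -/
theorem pertDeriv_pertChart₁ (p : (ℝ × ℝ) × (ℝ × ℝ)) (θ : ℝ) :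
    pertDeriv γ (pertChart₁ γ p) θ =
      deriv γ θ + (-Real.sin θ) • pertSolve₁ γ p + Real.cos θ • p.2 := rfl

/-- **Implicit differentiation: a non-transverse double point is a critical point of the chart
map.** If at `p = ((s, t), w) ∈ pertDom₁` the velocities of `pert γ (pertChart₁ γ p)` at `s` and
`t` satisfy `a • pert' s = b • pert' t`, then `((a, b), 0)` lies in the kernel of
`D(pertChart₁ γ) p`. (Differentiate the identity `pert (chart (line τ)) (s + τa) =
pert (chart (line τ)) (t + τb)` at `τ = 0`.) Guillemin–Pollack (1974), Ch. 2 §3.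
[cite: GuilleminPollack2010, Ch. 2 §3] -/
theorem fderiv_pertChart₁_apply_eq_zero (hγ : ContDiff ℝ ∞ γ) {p : (ℝ × ℝ) × (ℝ × ℝ)}
    (hp : p ∈ pertDom₁) {ab : ℝ × ℝ}
    (hab : ab.1 • pertDeriv γ (pertChart₁ γ p) p.1.1 = ab.2 • pertDeriv γ (pertChart₁ γ p) p.1.2) :
    fderiv ℝ (pertChart₁ γ) p (ab, 0) = 0 := by
  have hγd : Differentiable ℝ γ := hγ.differentiable (by simp)
  set s := p.1.1 with hs
  set t := p.1.2 with ht
  set w := p.2 with hw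
  set a := ab.1 with ha
  set b := ab.2 with hb
  set X := pertSolve₁ γ p with hX
  -- the derivative of the solution along the line
  set X' : ℝ × ℝ := fderiv ℝ (pertSolve₁ γ) p (ab, 0) with hX'
  have hline : HasDerivAt (pertSolve₁ γ ∘ pertLine p ab) X' 0 := by
    have hS : HasFDerivAt (pertSolve₁ γ) (fderiv ℝ (pertSolve₁ γ) p) (pertLine p ab 0) := by
      rw [pertLine_zero]; exact (differentiableAt_pertSolve₁ hγ hp).hasFDerivAt
    exact hS.comp_hasDerivAt 0 (hasDerivAt_pertLine p ab 0)
  -- the double-point identity along the line, as long as the line stays in the domain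
  set Φ : ℝ → ℝ × ℝ := fun τ ↦
    (γ (s + τ * a) - γ (t + τ * b)) +
      (Real.cos (s + τ * a) - Real.cos (t + τ * b)) • (pertSolve₁ γ ∘ pertLine p ab) τ +
      (Real.sin (s + τ * a) - Real.sin (t + τ * b)) • w with hΦ
  have hΦ0 : Φ =ᶠ[𝓝 0] fun _ ↦ 0 := by
    have hmem : ∀ᶠ τ in 𝓝 (0 : ℝ), pertLine p ab τ ∈ pertDom₁ := by
      refine (continuous_pertLine p ab).continuousAt.preimage_mem_nhds ?_
      rw [pertLine_zero]
      exact isOpen_pertDom₁.mem_nhds hp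
    filter_upwards [hmem] with τ hτ
    have h := pert_pertChart₁_eq (γ := γ) hτ
    simp only [pert_apply, pertChart₁, pertLine] at h
    simp only [hΦ, comp_apply, pertLine]
    rw [← sub_eq_zero] at h
    rw [← h]
    simp only [sub_smul]
    abel
  -- its derivative at `0`
  have hΦ' : HasDerivAt Φ
      ((a • deriv γ s - b • deriv γ t) +
        ((Real.cos (s + 0 * a) - Real.cos (t + 0 * b)) • X' +
          (-Real.sin s * a - -Real.sin t * b) • (pertSolve₁ γ ∘ pertLine p ab) 0) +
        (Real.cos s * a - Real.cos t * b) • w) 0 := by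
    have h1 := (hasDerivAt_comp_line hγd s a).sub (hasDerivAt_comp_line hγd t b)
    have h2 := ((hasDerivAt_cos_line s a).sub (hasDerivAt_cos_line t b)).smul hline
    have h3 := ((hasDerivAt_sin_line s a).sub (hasDerivAt_sin_line t b)).smul_const w
    exact (h1.add h2).add h3
  have hzero := hΦ'.unique ((hasDerivAt_const (0 : ℝ) (0 : ℝ × ℝ)).congr_of_eventuallyEq hΦ0)
  simp only [zero_mul, add_zero, comp_apply, pertLine_zero] at hzero
  rw [← hX] at hzero
  -- rearrange: `a • pert' s - b • pert' t + (cos s - cos t) • X' = 0`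
  have hkey : (Real.cos s - Real.cos t) • X' =
      -(a • pertDeriv γ (pertChart₁ γ p) s - b • pertDeriv γ (pertChart₁ γ p) t) := by
    rw [pertDeriv_pertChart₁, pertDeriv_pertChart₁, ← hX, ← hw]
    rw [← sub_eq_zero]
    rw [← hzero]
    module
  rw [hab, sub_self, neg_zero, smul_eq_zero] at hkey
  have hX'0 : X' = 0 := hkey.resolve_left (sub_ne_zero.2 hp)
  rw [fderiv_pertChart₁_apply hγ hp, ← hX', hX'0]
  rfl

/-- The **critical set** of the first chart map inside its domain. [folklore] -/
def pertCrit₁ (γ : ℝ → ℝ × ℝ) : Set ((ℝ × ℝ) × (ℝ × ℝ)) :=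
  {p | p ∈ pertDom₁ ∧ ¬ Injective (fderiv ℝ (pertChart₁ γ) p)}

/-- **Sard**: the critical values of the first chart map are null. [cite: Sard1942] -/
theorem measure_image_pertCrit₁ (μ : Measure ((ℝ × ℝ) × (ℝ × ℝ))) [IsAddHaarMeasure μ]
    (hγ : ContDiff ℝ ∞ γ) : μ (pertChart₁ γ '' pertCrit₁ γ) = 0 :=
  addHaar_image_eq_zero_of_det_fderivWithin_eq_zero μ (f' := fderiv ℝ (pertChart₁ γ))
    (fun _ hp ↦ (differentiableAt_pertChart₁ hγ hp.1).hasFDerivAt.hasFDerivWithinAt)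
    fun _ hp ↦ det_eq_zero_of_not_injective_clm hp.2

/-- A parameter with a non-transverse double point `(s, t)`, `cos s ≠ cos t`, is a critical value
of the first chart map. [folklore] -/
theorem mem_image_pertCrit₁ (hγ : ContDiff ℝ ∞ γ) {q : (ℝ × ℝ) × (ℝ × ℝ)} {s t : ℝ}
    (hst : Real.cos s ≠ Real.cos t) (h : pert γ q s = pert γ q t)
    (hc : cross (pertDeriv γ q s) (pertDeriv γ q t) = 0) : q ∈ pertChart₁ γ '' pertCrit₁ γ := by
  obtain ⟨ab, hab0, hab⟩ := exists_smul_eq_smul_of_cross_eq_zero hc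
  have hp : (((s, t), q.2) : (ℝ × ℝ) × (ℝ × ℝ)) ∈ pertDom₁ := hst
  have hq := pertChart₁_eq_of_pert_eq hst h
  refine ⟨((s, t), q.2), ⟨hp, fun hinj ↦ hab0 ?_⟩, hq⟩
  have hker := fderiv_pertChart₁_apply_eq_zero hγ hp (ab := ab) (by rw [hq]; exact hab)
  have h0 : ((ab, 0) : (ℝ × ℝ) × (ℝ × ℝ)) = 0 := hinj (by rw [hker, map_zero])
  exact (Prod.mk_eq_zero.1 h0).1


/-! ### The second chart: solving the double-point equation for `w` -/

/-- **Solving the double-point equation for `w`** where `sin s ≠ sin t`: for `p = ((s, t), v)`,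
`pertSolve₂ γ p = (sin s - sin t)⁻¹ • (-(γ s - γ t) - (cos s - cos t) • v)`. [folklore] -/
def pertSolve₂ (γ : ℝ → ℝ × ℝ) (p : (ℝ × ℝ) × (ℝ × ℝ)) : ℝ × ℝ :=
  (Real.sin p.1.1 - Real.sin p.1.2)⁻¹ •
    (-(γ p.1.1 - γ p.1.2) - (Real.cos p.1.1 - Real.cos p.1.2) • p.2)

/-- **The second chart map** `((s, t), v) ↦ (v, pertSolve₂)`. [folklore] -/
def pertChart₂ (γ : ℝ → ℝ × ℝ) (p : (ℝ × ℝ) × (ℝ × ℝ)) : (ℝ × ℝ) × (ℝ × ℝ) :=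
  (p.2, pertSolve₂ γ p)

/-- The domain `{sin s ≠ sin t}` of the second chart. [folklore] -/
def pertDom₂ : Set ((ℝ × ℝ) × (ℝ × ℝ)) :=
  {p | Real.sin p.1.1 ≠ Real.sin p.1.2}

/-- The domain of the second chart is open. [folklore] -/
theorem isOpen_pertDom₂ : IsOpen pertDom₂ :=
  isOpen_ne_fun (by fun_prop) (by fun_prop)

/-- The defining identity of `pertSolve₂`. [folklore] -/
theorem smul_pertSolve₂ {p : (ℝ × ℝ) × (ℝ × ℝ)} (hp : p ∈ pertDom₂) :
    (Real.sin p.1.1 - Real.sin p.1.2) • pertSolve₂ γ p =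
      -(γ p.1.1 - γ p.1.2) - (Real.cos p.1.1 - Real.cos p.1.2) • p.2 := by
  rw [pertSolve₂, smul_smul, mul_inv_cancel₀ (sub_ne_zero.2 hp), one_smul]

/-- **The graph property** of the second chart map. [folklore] -/
theorem pert_pertChart₂_eq {p : (ℝ × ℝ) × (ℝ × ℝ)} (hp : p ∈ pertDom₂) :
    pert γ (pertChart₂ γ p) p.1.1 = pert γ (pertChart₂ γ p) p.1.2 := by
  have h := smul_pertSolve₂ (γ := γ) hp
  simp only [pert_apply, pertChart₂]
  rw [sub_smul] at h
  linear_combination (norm := module) h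

/-- **Uniqueness** for the second chart: a parameter `q` with the double point `(s, t)`,
`sin s ≠ sin t`, is the value of the second chart map at `((s, t), q.1)`. [folklore] -/
theorem pertChart₂_eq_of_pert_eq {q : (ℝ × ℝ) × (ℝ × ℝ)} {s t : ℝ} (hst : Real.sin s ≠ Real.sin t)
    (h : pert γ q s = pert γ q t) : pertChart₂ γ ((s, t), q.1) = q := by
  refine Prod.ext rfl ?_
  show pertSolve₂ γ ((s, t), q.1) = q.2
  have hc : Real.sin s - Real.sin t ≠ 0 := sub_ne_zero.2 hst
  have hq : (Real.sin s - Real.sin t) • q.2 = -(γ s - γ t) - (Real.cos s - Real.cos t) • q.1 := by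
    rw [pert_apply, pert_apply] at h
    rw [sub_smul, sub_smul]
    linear_combination (norm := module) h
  rw [pertSolve₂]
  show (Real.sin s - Real.sin t)⁻¹ • (-(γ s - γ t) - (Real.cos s - Real.cos t) • q.1) = q.2
  rw [← hq, smul_smul, inv_mul_cancel₀ hc, one_smul]

/-- `pertSolve₂` is `C^∞` on the domain. [folklore] -/
theorem contDiffOn_pertSolve₂ (hγ : ContDiff ℝ ∞ γ) : ContDiffOn ℝ ∞ (pertSolve₂ γ) pertDom₂ := by
  have h1 : ContDiff ℝ ∞ fun p : (ℝ × ℝ) × (ℝ × ℝ) ↦ γ p.1.1 := hγ.comp (contDiff_fst.comp contDiff_fst)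
  have h2 : ContDiff ℝ ∞ fun p : (ℝ × ℝ) × (ℝ × ℝ) ↦ γ p.1.2 := hγ.comp (contDiff_snd.comp contDiff_fst)
  have hinv : ContDiffOn ℝ ∞ (fun p : (ℝ × ℝ) × (ℝ × ℝ) ↦ (Real.sin p.1.1 - Real.sin p.1.2)⁻¹)
      pertDom₂ :=
    ContDiffOn.inv (by fun_prop) fun p hp ↦ sub_ne_zero.2 hp
  unfold pertSolve₂
  refine hinv.smul (ContDiff.contDiffOn ?_)
  exact (h1.sub h2).neg.sub ((Real.contDiff_cos.comp (contDiff_fst.comp contDiff_fst)).sub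
    (Real.contDiff_cos.comp (contDiff_snd.comp contDiff_fst)) |>.smul contDiff_snd)

/-- The second chart map is `C^∞` on the domain. [folklore] -/
theorem contDiffOn_pertChart₂ (hγ : ContDiff ℝ ∞ γ) : ContDiffOn ℝ ∞ (pertChart₂ γ) pertDom₂ :=
  contDiffOn_snd.prodMk (contDiffOn_pertSolve₂ hγ)

/-- `pertSolve₂` is differentiable at the points of the domain. [folklore] -/
theorem differentiableAt_pertSolve₂ (hγ : ContDiff ℝ ∞ γ) {p : (ℝ × ℝ) × (ℝ × ℝ)}
    (hp : p ∈ pertDom₂) : DifferentiableAt ℝ (pertSolve₂ γ) p :=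
  ((contDiffOn_pertSolve₂ hγ).differentiableOn (by simp) p hp).differentiableAt
    (isOpen_pertDom₂.mem_nhds hp)

/-- The second chart map is differentiable at the points of the domain. [folklore] -/
theorem differentiableAt_pertChart₂ (hγ : ContDiff ℝ ∞ γ) {p : (ℝ × ℝ) × (ℝ × ℝ)}
    (hp : p ∈ pertDom₂) : DifferentiableAt ℝ (pertChart₂ γ) p :=
  differentiableAt_snd.prodMk (differentiableAt_pertSolve₂ hγ hp)

/-- The differential of the second chart map: `D(pertChart₂) z = (z.2, D(pertSolve₂) z)`.
[folklore] -/
theorem fderiv_pertChart₂_apply (hγ : ContDiff ℝ ∞ γ) {p : (ℝ × ℝ) × (ℝ × ℝ)} (hp : p ∈ pertDom₂)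
    (z : (ℝ × ℝ) × (ℝ × ℝ)) :
    fderiv ℝ (pertChart₂ γ) p z = (z.2, fderiv ℝ (pertSolve₂ γ) p z) := by
  have h := (hasFDerivAt_snd (p := p)).prodMk (differentiableAt_pertSolve₂ hγ hp).hasFDerivAt
  rw [show pertChart₂ γ = fun p ↦ (p.2, pertSolve₂ γ p) from rfl, h.fderiv]
  rfl

/-- The velocity of the perturbed curve for the parameter `pertChart₂ γ p = (v, pertSolve₂ γ p)`.
[folklore] -/
theorem pertDeriv_pertChart₂ (p : (ℝ × ℝ) × (ℝ × ℝ)) (θ : ℝ) :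
    pertDeriv γ (pertChart₂ γ p) θ =
      deriv γ θ + (-Real.sin θ) • p.2 + Real.cos θ • pertSolve₂ γ p := rfl

/-- **Implicit differentiation for the second chart**: if at `p = ((s, t), v) ∈ pertDom₂` the
velocities of `pert γ (pertChart₂ γ p)` at `s` and `t` satisfy `a • pert' s = b • pert' t`, then
`((a, b), 0)` lies in the kernel of `D(pertChart₂ γ) p`. Guillemin–Pollack (1974), Ch. 2 §3.
[cite: GuilleminPollack2010, Ch. 2 §3] -/
theorem fderiv_pertChart₂_apply_eq_zero (hγ : ContDiff ℝ ∞ γ) {p : (ℝ × ℝ) × (ℝ × ℝ)}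
    (hp : p ∈ pertDom₂) {ab : ℝ × ℝ}
    (hab : ab.1 • pertDeriv γ (pertChart₂ γ p) p.1.1 = ab.2 • pertDeriv γ (pertChart₂ γ p) p.1.2) :
    fderiv ℝ (pertChart₂ γ) p (ab, 0) = 0 := by
  have hγd : Differentiable ℝ γ := hγ.differentiable (by simp)
  set s := p.1.1 with hs
  set t := p.1.2 with ht
  set v := p.2 with hv
  set a := ab.1 with ha
  set b := ab.2 with hb
  set X := pertSolve₂ γ p with hX
  -- the derivative of the solution along the line
  set X' : ℝ × ℝ := fderiv ℝ (pertSolve₂ γ) p (ab, 0) with hX'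
  have hline : HasDerivAt (pertSolve₂ γ ∘ pertLine p ab) X' 0 := by
    have hS : HasFDerivAt (pertSolve₂ γ) (fderiv ℝ (pertSolve₂ γ) p) (pertLine p ab 0) := by
      rw [pertLine_zero]; exact (differentiableAt_pertSolve₂ hγ hp).hasFDerivAt
    exact hS.comp_hasDerivAt 0 (hasDerivAt_pertLine p ab 0)
  -- the double-point identity along the line, as long as the line stays in the domain
  set Φ : ℝ → ℝ × ℝ := fun τ ↦
    (γ (s + τ * a) - γ (t + τ * b)) +
      (Real.cos (s + τ * a) - Real.cos (t + τ * b)) • v +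
      (Real.sin (s + τ * a) - Real.sin (t + τ * b)) • (pertSolve₂ γ ∘ pertLine p ab) τ with hΦ
  have hΦ0 : Φ =ᶠ[𝓝 0] fun _ ↦ 0 := by
    have hmem : ∀ᶠ τ in 𝓝 (0 : ℝ), pertLine p ab τ ∈ pertDom₂ := by
      refine (continuous_pertLine p ab).continuousAt.preimage_mem_nhds ?_
      rw [pertLine_zero]
      exact isOpen_pertDom₂.mem_nhds hp
    filter_upwards [hmem] with τ hτ
    have h := pert_pertChart₂_eq (γ := γ) hτ
    simp only [pert_apply, pertChart₂, pertLine] at h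
    simp only [hΦ, comp_apply, pertLine]
    rw [← sub_eq_zero] at h
    rw [← h]
    simp only [sub_smul]
    abel
  -- its derivative at `0`
  have hΦ' : HasDerivAt Φ
      ((a • deriv γ s - b • deriv γ t) +
        (-Real.sin s * a - -Real.sin t * b) • v +
        ((Real.sin (s + 0 * a) - Real.sin (t + 0 * b)) • X' +
          (Real.cos s * a - Real.cos t * b) • (pertSolve₂ γ ∘ pertLine p ab) 0)) 0 := by
    have h1 := (hasDerivAt_comp_line hγd s a).sub (hasDerivAt_comp_line hγd t b)
    have h2 := ((hasDerivAt_cos_line s a).sub (hasDerivAt_cos_line t b)).smul_const v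
    have h3 := ((hasDerivAt_sin_line s a).sub (hasDerivAt_sin_line t b)).smul hline
    exact (h1.add h2).add h3
  have hzero := hΦ'.unique ((hasDerivAt_const (0 : ℝ) (0 : ℝ × ℝ)).congr_of_eventuallyEq hΦ0)
  simp only [zero_mul, add_zero, comp_apply, pertLine_zero] at hzero
  rw [← hX] at hzero
  -- rearrange: `a • pert' s - b • pert' t + (sin s - sin t) • X' = 0`
  have hkey : (Real.sin s - Real.sin t) • X' =
      -(a • pertDeriv γ (pertChart₂ γ p) s - b • pertDeriv γ (pertChart₂ γ p) t) := by
    rw [pertDeriv_pertChart₂, pertDeriv_pertChart₂, ← hX, ← hv]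
    rw [← sub_eq_zero]
    rw [← hzero]
    module
  rw [hab, sub_self, neg_zero, smul_eq_zero] at hkey
  have hX'0 : X' = 0 := hkey.resolve_left (sub_ne_zero.2 hp)
  rw [fderiv_pertChart₂_apply hγ hp, ← hX', hX'0]
  rfl

/-- The **critical set** of the second chart map inside its domain. [folklore] -/
def pertCrit₂ (γ : ℝ → ℝ × ℝ) : Set ((ℝ × ℝ) × (ℝ × ℝ)) :=
  {p | p ∈ pertDom₂ ∧ ¬ Injective (fderiv ℝ (pertChart₂ γ) p)}

/-- **Sard**: the critical values of the second chart map are null. [cite: Sard1942] -/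
theorem measure_image_pertCrit₂ (μ : Measure ((ℝ × ℝ) × (ℝ × ℝ))) [IsAddHaarMeasure μ]
    (hγ : ContDiff ℝ ∞ γ) : μ (pertChart₂ γ '' pertCrit₂ γ) = 0 :=
  addHaar_image_eq_zero_of_det_fderivWithin_eq_zero μ (f' := fderiv ℝ (pertChart₂ γ))
    (fun _ hp ↦ (differentiableAt_pertChart₂ hγ hp.1).hasFDerivAt.hasFDerivWithinAt)
    fun _ hp ↦ det_eq_zero_of_not_injective_clm hp.2

/-- A parameter with a non-transverse double point `(s, t)`, `sin s ≠ sin t`, is a critical value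
of the second chart map. [folklore] -/
theorem mem_image_pertCrit₂ (hγ : ContDiff ℝ ∞ γ) {q : (ℝ × ℝ) × (ℝ × ℝ)} {s t : ℝ}
    (hst : Real.sin s ≠ Real.sin t) (h : pert γ q s = pert γ q t)
    (hc : cross (pertDeriv γ q s) (pertDeriv γ q t) = 0) : q ∈ pertChart₂ γ '' pertCrit₂ γ := by
  obtain ⟨ab, hab0, hab⟩ := exists_smul_eq_smul_of_cross_eq_zero hc
  have hp : (((s, t), q.1) : (ℝ × ℝ) × (ℝ × ℝ)) ∈ pertDom₂ := hst
  have hq := pertChart₂_eq_of_pert_eq hst h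
  refine ⟨((s, t), q.1), ⟨hp, fun hinj ↦ hab0 ?_⟩, hq⟩
  have hker := fderiv_pertChart₂_apply_eq_zero hγ hp (ab := ab) (by rw [hq]; exact hab)
  have h0 : ((ab, 0) : (ℝ × ℝ) × (ℝ × ℝ)) = 0 := hinj (by rw [hker, map_zero])
  exact (Prod.mk_eq_zero.1 h0).1

/-! ### Assembly: generic parameters -/

/-- The set of parameters with a **non-transverse double point**, presented as the critical values
of the two chart maps. [folklore] -/
def pertBad₂ (γ : ℝ → ℝ × ℝ) : Set ((ℝ × ℝ) × (ℝ × ℝ)) :=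
  pertChart₁ γ '' pertCrit₁ γ ∪ pertChart₂ γ '' pertCrit₂ γ

/-- **Almost every perturbation has only transverse double points**: the parameters with a
non-transverse double point are null (Sard's theorem for the two chart maps). Sard (1942);
Milnor (1965), §3; Guillemin–Pollack (1974), Ch. 2 §3. [cite: Sard1942] -/
theorem measure_pertBad₂_eq_zero (μ : Measure ((ℝ × ℝ) × (ℝ × ℝ))) [IsAddHaarMeasure μ]
    (hγ : ContDiff ℝ ∞ γ) : μ (pertBad₂ γ) = 0 :=
  measure_union_null (measure_image_pertCrit₁ μ hγ) (measure_image_pertCrit₂ μ hγ)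

/-- **Transversality off the bad set**: for `q ∉ pertBad₂ γ`, at every double point
`pert γ q s = pert γ q t` with `s ≢ t (mod 2π)` the two velocities are linearly independent.
[folklore] -/
theorem cross_pertDeriv_ne_zero (hγ : ContDiff ℝ ∞ γ) {q : (ℝ × ℝ) × (ℝ × ℝ)}
    (hq : q ∉ pertBad₂ γ) {s t : ℝ} (hst : ¬ (Real.cos s = Real.cos t ∧ Real.sin s = Real.sin t))
    (h : pert γ q s = pert γ q t) : cross (pertDeriv γ q s) (pertDeriv γ q t) ≠ 0 := by
  intro hc
  by_cases hcos : Real.cos s = Real.cos t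
  · have hsin : Real.sin s ≠ Real.sin t := fun hsin ↦ hst ⟨hcos, hsin⟩
    exact hq (Or.inr (mem_image_pertCrit₂ hγ hsin h hc))
  · exact hq (Or.inl (mem_image_pertCrit₁ hγ hcos h hc))

/-- **Generic small perturbations exist.** For a `C^∞` plane curve `γ` and every `ε > 0` there is
a parameter `q = (v, w)` with `‖v‖ + ‖w‖ < ε` such that the perturbed curve
`pert γ q = γ + cos • v + sin • w` is an immersion, all its double points `s ≢ t (mod 2π)` are
transverse, and it has no triple points (the union of the three null sets of
`measure_setOf_pertDeriv_eq_zero`, `measure_pertBad₂_eq_zero`, `measure_pertBad₃_eq_zero` omits a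
point of every ball). Milnor (1965), §§2–3; Cromwell (2004), Thm. 3.2.1 (regular projections).
[cite: MilnorTDV1965, §3] -/
theorem exists_pert_generic (hγ : ContDiff ℝ ∞ γ) {ε : ℝ} (hε : 0 < ε) :
    ∃ q : (ℝ × ℝ) × (ℝ × ℝ), ‖q.1‖ + ‖q.2‖ < ε ∧
      (∀ s, pertDeriv γ q s ≠ 0) ∧
      (∀ s t, ¬ (Real.cos s = Real.cos t ∧ Real.sin s = Real.sin t) →
        pert γ q s = pert γ q t → cross (pertDeriv γ q s) (pertDeriv γ q t) ≠ 0) ∧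
      q ∉ pertBad₃ γ := by
  set μ : Measure ((ℝ × ℝ) × (ℝ × ℝ)) := Measure.addHaar with hμ
  have hnull : μ ({q | ∃ s, pertDeriv γ q s = 0} ∪ pertBad₂ γ ∪ pertBad₃ γ) = 0 :=
    measure_union_null (measure_union_null (measure_setOf_pertDeriv_eq_zero μ hγ)
      (measure_pertBad₂_eq_zero μ hγ)) (measure_pertBad₃_eq_zero μ (hγ.differentiable (by simp)))
  obtain ⟨q, hq, hqN⟩ := exists_mem_notMem_of_measure_zero μ (Metric.isOpen_ball)
    ⟨(0 : (ℝ × ℝ) × (ℝ × ℝ)), Metric.mem_ball_self (half_pos hε)⟩ hnull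
  simp only [mem_union, mem_setOf_eq, not_or, not_exists] at hqN
  obtain ⟨⟨h1, h2⟩, h3⟩ := hqN
  refine ⟨q, ?_, h1, fun s t hst h ↦ cross_pertDeriv_ne_zero hγ h2 hst h, h3⟩
  rw [Metric.mem_ball, dist_zero_right] at hq
  have := norm_fst_le q
  have := norm_snd_le q
  linarith


end Literature.Topology.FourManifolds
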